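import Summits.QuantumFields.YangMills.Theorems.LuscherReductionTraceDoorDefs
import HarnessLib

/-!
# Crux RED `RunningReduction` (stmt-QuantumFields-19978), child `TwistedTraceScaling` (stmt-QuantumFields-20203): the UPPER-HALF TT DOOR —
# DEFINITIONS: the one-sided vacuum-normalised trace law `UpperTraceLawAt s ε` and the femto Weyl bound `FemtoWeylAt s0`

Support DEFINITIONS of the `FemtoTransferGap` group (fleet service by seat ym-infvol-p2 g7; route `LuscherReduction`, owner ym-beyond-p1, femto
rung R2b1).  SOURCE: the planner's kernel-checked crux workfile `Summits/QuantumFields/YangMills/Cruxes/RunningReduction/Lines/upper_trace_door.lean`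
rev 3 (commit efcd23ff80e7, sha16 fb9acfdf08f96b2f, 1401 lines, `rc 0 · 0 sorry`, tree imports only; seat ym-cruxidea-19978-1 GEN 7–8, memo
`…/Lines/upper_trace_door.md` rev 4), which is NOT importable on the farm.  There the two currencies are CLOSED propositions
`UTD.UpperTraceLaw := ∀ s, 0 < s → ∀ ε, 0 < ε → …` and `UTD.FemtoWeyl := ∀ s0, 0 < s0 → …`; here each is the PARAMETER-INDEXED PREDICATE obtained by
deleting that leading quantifier prefix — texts otherwise BYTE-IDENTICAL — so that
`UTD.UpperTraceLaw ↔ ∀ s, 0 < s → ∀ ε, 0 < ε → UTD.UpperTraceLawAt s ε` and `UTD.FemtoWeyl ↔ ∀ s0, 0 < s0 → UTD.FemtoWeylAt s0` hold by `Iff.rfl`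
(same device as `Theorems/LuscherReductionDressedRitzPlateauDefs.lean` and `…ExplicitNoIntruderDefs.lean`).  The companion proof files
`Theorems/LuscherReductionUpperTraceDoor{Basics,Sandwich,Weyl,OfCoarseLevels,Converse}.lean` re-home the workfile's theorems over these predicates:
`UTL ∧ DressedRitz ⟹ RunningReduction` (the one-sided door), `TwistedTraceScaling ⟹ UTL` (unconditional) and
`UTL ∧ OneSiteTail ∧ DressedRitz ⟹ TwistedTraceScaling` (so, given the sibling child `DressedRitz` 20205, the cuts `{TTS, DressedRitz}` and
`{UTL, DressedRitz}` of RED coincide).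

The other two currencies of the workfile (`CoarseNoIntruder`, `CoarseLevels`) are NOT defined here: following
`Theorems/LuscherReductionTraceDoorDefs.lean` they are SPELLED OUT as hypothesis ∕ conclusion texts in the proof files (they are the `hCO` text of the
tree's `TraceDoor.runningReduction_of_coarseNoIntruder` and the conclusion text of `TraceDoor.coarseLevels_of_twistedTraceScaling`).

* `UTD.UpperTraceLawAt s ε` — at femto-time `s` with precision `ε`: deep in the femto window, at `T = femtoSteps s β L = ⌈sL/λ⌉` steps and one-site
  coupling `B = oneSiteCoupling β L = 2L³/λ³`, `Z_phys(L,β,T) ≤ (Z_phys(1,B,T)/μ_0(B)^T + ε)·λ_0(L,β)^T`; in level currency (closed child `TraceFormula`):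
  `Σ_j (λ_j/λ_0)^T ≤ Σ_i (μ_i/μ_0)^T + ε` — "no excess low-lying zero-flux spectral weight relative to the one-site tower".  ONE-SIDED and at ONE femto-time
  per instance; the vacuum normalisation `λ_0^T` makes the extensive `O(g²L³)` vacuum energies cancel.  `upperTraceLawAt_iff_raw` certifies `Iff.rfl`
  agreement with the route-file spelling of memo §5 (`⌈s * L / luscherLambda β L⌉₊` inlined).
* `UTD.FemtoWeylAt s0` — uniform boundedness of the vacuum-normalised femto partition function at femto-time `s0` (the full-theory analogue of the closed
  child `OneSiteTail`).

Nothing is asserted here.  HONEST FRAMING: femto rung R2b1 (`FemtoGapOfRecord`) vocabulary; `∀ s ε, UpperTraceLawAt s ε` is OPEN (XL: the no-intruder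
half of Lüscher's reduction in partition-function form); nothing here bears on infinite volume, the continuum limit in large volume, or the Clay mass gap.
References: M. Lüscher, Nucl. Phys. B219 (1983) 233 [cite: Luscher1983, §3]; T. Bałaban, Commun. Math. Phys. 122 (1989) 355 [cite: Balaban1989LargeFieldII].
-/

set_option autoImplicit false

noncomputable section

open MeasureTheory Filter Topology Real
open scoped BigOperators

namespace Summit.QuantumFields.YangMills.Theorems.FemtoTransferGap

open Summit.QuantumFields.YangMills.Theorems.FemtoTransferGap.TT (physTrace)
open Summit.QuantumFields.YangMills.Theorems.FemtoTransferGap.TraceDoor (femtoSteps)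

/-- **`UTD.UpperTraceLawAt s ε`** — the ONE-SIDED upper trace law at femto-time `s` with precision `ε` (the `(s, ε)`-slice of the workfile's
`UTD.UpperTraceLaw`, text VERBATIM): there is a window threshold `lam0 > 0` such that for every `0 < lam ≤ lam0`, eventually in `L`, for every `β` in
the femto window, the zero-flux partition function at `T = ⌈sL/λ⌉` steps is at most the one-site one (at `B = 2L³/λ³`, same `T`), both in units of
their vacuum: `Z_phys(L,β,T) ≤ (Z_phys(1,B,T)/μ_0^T + ε)·λ_0^T`.  OPEN (XL).  [cite: Luscher1983, §3] [cite: Balaban1989LargeFieldII, p.355] -/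
def UTD.UpperTraceLawAt (s ε : ℝ) : Prop :=
  ∃ lam0 : ℝ, 0 < lam0 ∧ ∀ lam : ℝ, 0 < lam → lam ≤ lam0 →
    ∃ L0 : ℕ, ∀ (L : ℕ) [NeZero L], L0 ≤ L → ∀ β : ℝ, InFemtoWindow lam β L →
      physTrace L β (femtoSteps s β L) ≤
        (physTrace 1 (oneSiteCoupling β L) (femtoSteps s β L) / levelValue su2Rep 1 (oneSiteCoupling β L) 0 ^ femtoSteps s β L + ε) *
          levelValue su2Rep L β 0 ^ femtoSteps s β L

/-- **`UTD.FemtoWeylAt s0`** — femto Weyl bound at femto-time `s0` (the `s0`-slice of the workfile's `UTD.FemtoWeyl`, text VERBATIM): for some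
constant `C`, deep in the window `Z_phys(L,β,⌈s0·L/λ⌉) ≤ C·λ_0^{⌈s0·L/λ⌉}` ("no accumulation of zero-flux levels below energy `O(λ/L)` beyond a
Laplace-summable tower"; the full-theory analogue of the child `OneSiteTail`).  Implied by the upper trace law and by `TwistedTraceScaling`
(each with `OneSiteTail`): `Theorems/LuscherReductionUpperTraceDoorWeyl.lean`. [cite: Luscher1983, §3] -/
def UTD.FemtoWeylAt (s0 : ℝ) : Prop :=
  ∃ C : ℝ, ∃ lam0 : ℝ, 0 < lam0 ∧ ∀ lam : ℝ, 0 < lam → lam ≤ lam0 →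
    ∃ L0 : ℕ, ∀ (L : ℕ) [NeZero L], L0 ≤ L → ∀ β : ℝ, InFemtoWindow lam β L →
      physTrace L β (femtoSteps s0 β L) ≤ C * levelValue su2Rep L β 0 ^ femtoSteps s0 β L

/-- Certificate: `UTD.UpperTraceLawAt s ε` is `Iff.rfl`-equal to the ROUTE-FILE SPELLING of memo `upper_trace_door.md` §5 (restatement kit), i.e. with
`femtoSteps s β L = ⌈s * L / luscherLambda β L⌉₊` inlined — so a future route item with that text is served by the companion theorems by `exact`.
[cite: Luscher1983, §3] -/
theorem UTD.upperTraceLawAt_iff_raw (s ε : ℝ) :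
    UTD.UpperTraceLawAt s ε ↔
      ∃ lam0 : ℝ, 0 < lam0 ∧ ∀ lam : ℝ, 0 < lam → lam ≤ lam0 →
        ∃ L0 : ℕ, ∀ (L : ℕ) [NeZero L], L0 ≤ L → ∀ β : ℝ, InFemtoWindow lam β L →
          physTrace L β ⌈s * L / luscherLambda β L⌉₊ ≤
            (physTrace 1 (oneSiteCoupling β L) ⌈s * L / luscherLambda β L⌉₊ /
                  levelValue su2Rep 1 (oneSiteCoupling β L) 0 ^ ⌈s * L / luscherLambda β L⌉₊ + ε) *
              levelValue su2Rep L β 0 ^ ⌈s * L / luscherLambda β L⌉₊ :=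
  Iff.rfl

end Summit.QuantumFields.YangMills.Theorems.FemtoTransferGap

end
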